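import Summits.MatrixMultiplication.OmegaCensus.SmallFormats.InvertiblePointNearFrame
import HarnessLib

/-!
# ω-census family (a): the LINE-COLUMN LAW WITH DEFECT at a near-frame point of `⟨2,2,n⟩`

Cell `pub-omega` (unit `pub-omega-tensor-g25`), topic `Summits/MatrixMultiplication/OmegaCensus` (sub-folder `SmallFormats`).
Framing (verbatim): lottery ticket; floor = certified bounds/negative ranges. HONEST FRAMING: an elementary structural identity over an
arbitrary field, the `|O| = 2n + 1` companion of `lineCol_eq_zero_of_forall_g_eq_zero` (`InvertiblePointLineColumns`, p471507), built on
the near-frame identities of `InvertiblePointNearFrame`. It is the first structural handle on the 'J1 (line) columns' of the Kronecker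
types met by the near-frame search stage of the `𝔽₃` `⟨2,2,6⟩ @ 20` census (tensor g24/g25 `NEAR-FRAME.md` §7); not a rank bound,
nothing on `ω`.

**Setting (`X₀ = 1`, `|O| = 2n + 1`).** `ρ, σ` as in `exists_nearFrame` (`f_s(1) g_s(W_j) = δ_{sj} + ρ_s σ_j`), `j₀ ∈ O` with
`σ_s = l_s σ_{j₀}` on `O` and `l_{j₀} = 1` (i.e. `l_s = σ_s/σ_{j₀}` when `σ_{j₀} ≠ 0`), reduced basis `W'_s := W_s − l_s W_{j₀}`,
defect coefficient `e(X,W) := Σ_{s∈O} l_s f_s(X) g_s(W)`. A column `j` is a LINE COLUMN with direction `ζ ≠ 0` if column `j` of every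
`W_t` (`t ∉ O`) AND of `W_{j₀}` lies on `k·ζ` — i.e. of the target space `span{W_t : t ∉ O} + k·W_{j₀}` of the reduced footprints.
* `nearBasis_footprint_col`, `nearBasis_col_not_on_line`, `near_f_vecMulVec_eq_zero`: the column footprint of `W'_s` lies on the
  line; a nonzero `j`-th column of `W'_s` is never on the line, and then `f_s` kills every `X` with range in `k·ζ`;
* `nearLineCol_eq`: for `W ∈ K₀ := ⋂_{t∉O} ker g_t` and column `j` of `W_{j₀}` equal to `w₀·ζ`: `W_{ij} = w₀ · e(ζ e_iᵀ, W)`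
  (Brent in the reduced frame at `X = ζ e_iᵀ`: all frame terms and all `Z`-terms die, only the defect term survives);
* `nearLineCol_eq_zero`: hence the line columns of `K₀` vanish at every line column where `W_{j₀}` has a zero entry column — the
  saturated-case conclusion — while in general a line column of `K₀` is read off from the defect functional `e(·,W)`;
* `near_lineColumnShape_defect_rank` (partial no-go, v2): for a line-column shape `J` with `|J| < n` and `|ι| ≤ 2n + 2|J|` (the census
  T-family `LT1+LT1+J1⁴`: `20 ≤ 12 + 8`) the defect form `e(X,W)` on `M₂ × K₀` is never of rank `≤ 1` — otherwise the argument of the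
  saturated no-go `not_lineColumnShape_one` runs on `K₀ ∩ ker lam0`.
-/

namespace Summit.MatrixMultiplication.OmegaCensus.SmallFormats

open Module Matrix Literature.Computability.AlgebraicComplexity

variable {k : Type*} [Field k] {n : ℕ} {ι : Type*} [Fintype ι]

section LineColumns

variable (β : BilinComp (mulBilin k 2 2 n) ι) (O : Finset ι)

/-- **Column footprint of a reduced basis vector on a line column.** If column `j` of every `W_t` (`t ∉ O`) and of `W_{j₀}` lies
on the line `k·ζ`, and `σ_s = l σ_{j₀}`, then for every `X` the `j`-th column of `X W'_s − c_s(X) W'_s` (`W'_s = W_s − l W_{j₀}`)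
lies on that line. -/
theorem nearBasis_footprint_col [DecidableEq ι] (hO' : ∀ i ∈ O, β.f i 1 ≠ 0) {ρ σ : ι → k}
    (hM : ∀ s ∈ O, ∀ j ∈ O, β.f s 1 * β.g s (β.w j) = (if s = j then 1 else 0) + ρ s * σ j)
    {j₀ : ι} (hj₀ : j₀ ∈ O) {j : Fin n} {ζ : Fin 2 → k} (hT : ∀ t, t ∉ O → ∃ c : k, ∀ r, β.w t r j = c * ζ r)
    (hQ : ∃ c : k, ∀ r, β.w j₀ r j = c * ζ r) {s : ι} (hs : s ∈ O) {l : k} (hl : σ s = l * σ j₀)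
    (X : Matrix (Fin 2) (Fin 2) k) :
    ∃ d : k, ∀ r, (X * (β.w s - l • β.w j₀)) r j - β.f s X * (β.f s 1)⁻¹ * (β.w s - l • β.w j₀) r j = d * ζ r := by
  classical
  have h := nearBasis_footprint_eq β O hO' hM hj₀ hs hl X
  choose! cf hcf using hT
  obtain ⟨c₀, hc₀⟩ := hQ
  refine ⟨l * (β.f s X * (β.f s 1)⁻¹ - β.f j₀ X * (β.f j₀ 1)⁻¹) * c₀ +
    ∑ t ∈ Finset.univ \ O, β.f t X * β.g t (β.w s - l • β.w j₀) * cf t, fun r => ?_⟩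
  have hr := congr_fun (congr_fun h r) j
  rw [Matrix.sub_apply, Matrix.smul_apply, smul_eq_mul] at hr
  rw [hr, Matrix.add_apply, Matrix.smul_apply, smul_eq_mul, hc₀ r, Matrix.sum_apply, add_mul, Finset.sum_mul]
  congr 1
  · ring
  · refine Finset.sum_congr rfl fun t ht => ?_
    rw [Matrix.smul_apply, smul_eq_mul, hcf t (Finset.mem_sdiff.mp ht).2 r]
    ring

/-- **A line column of a reduced basis vector is never ON the line** (unless zero): same computation as `col_not_on_line`
(footprints at `E₁₂`, `E₂₁`). -/
theorem nearBasis_col_not_on_line [DecidableEq ι] (hO' : ∀ i ∈ O, β.f i 1 ≠ 0) {ρ σ : ι → k}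
    (hM : ∀ s ∈ O, ∀ j ∈ O, β.f s 1 * β.g s (β.w j) = (if s = j then 1 else 0) + ρ s * σ j)
    {j₀ : ι} (hj₀ : j₀ ∈ O) {j : Fin n} {ζ : Fin 2 → k} (hζ : ζ ≠ 0) (hT : ∀ t, t ∉ O → ∃ c : k, ∀ r, β.w t r j = c * ζ r)
    (hQ : ∃ c : k, ∀ r, β.w j₀ r j = c * ζ r) {s : ι} (hs : s ∈ O) {l : k} (hl : σ s = l * σ j₀)
    {e : k} (hcol : ∀ r, (β.w s - l • β.w j₀) r j = e * ζ r) (he : e ≠ 0) : False := by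
  obtain ⟨d₁, hd₁⟩ := nearBasis_footprint_col β O hO' hM hj₀ hT hQ hs hl (single 0 1 1)
  obtain ⟨d₂, hd₂⟩ := nearBasis_footprint_col β O hO' hM hj₀ hT hQ hs hl (single 1 0 1)
  set W' := β.w s - l • β.w j₀ with hW'
  have E1 := hd₁ 0
  have E2 := hd₁ 1
  have E3 := hd₂ 0
  have E4 := hd₂ 1
  rw [single_mul_apply_same, one_mul, hcol 0, hcol 1] at E1
  rw [single_mul_apply_of_ne (h := one_ne_zero), hcol 1] at E2
  rw [single_mul_apply_of_ne (h := zero_ne_one), hcol 0] at E3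
  rw [single_mul_apply_same, one_mul, hcol 0, hcol 1] at E4
  set c₁ := β.f s (single 0 1 1) * (β.f s 1)⁻¹
  set c₂ := β.f s (single 1 0 1) * (β.f s 1)⁻¹
  have hz1 : e * (ζ 1 * ζ 1) = 0 := by linear_combination ζ 1 * E1 - ζ 0 * E2
  have hζ1 : ζ 1 = 0 := by
    rcases mul_eq_zero.mp hz1 with h0 | h0
    · exact absurd h0 he
    · exact mul_self_eq_zero.mp h0
  have hz0 : e * ζ 0 = 0 := by rw [hζ1] at E4; linear_combination E4
  have hζ0 : ζ 0 = 0 := by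
    rcases mul_eq_zero.mp hz0 with h0 | h0
    · exact absurd h0 he
    · exact h0
  apply hζ; funext r; fin_cases r
  · exact hζ0
  · exact hζ1

/-- **Off forms vanish on matrices with range in the line.** If the `j`-th column of `W'_s = W_s − l W_{j₀}` (`s ∈ O`) is nonzero,
then `f_s(ζ e_iᵀ) = 0` for `i = 1, 2`. -/
theorem near_f_vecMulVec_eq_zero [DecidableEq ι] (hO' : ∀ i ∈ O, β.f i 1 ≠ 0) {ρ σ : ι → k}
    (hM : ∀ s ∈ O, ∀ j ∈ O, β.f s 1 * β.g s (β.w j) = (if s = j then 1 else 0) + ρ s * σ j)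
    {j₀ : ι} (hj₀ : j₀ ∈ O) {j : Fin n} {ζ : Fin 2 → k} (hζ : ζ ≠ 0) (hT : ∀ t, t ∉ O → ∃ c : k, ∀ r, β.w t r j = c * ζ r)
    (hQ : ∃ c : k, ∀ r, β.w j₀ r j = c * ζ r) {s : ι} (hs : s ∈ O) {l : k} (hl : σ s = l * σ j₀)
    (hne : ∃ r, (β.w s - l • β.w j₀) r j ≠ 0) (i : Fin 2) : β.f s (vecMulVec ζ (Pi.single i 1)) = 0 := by
  obtain ⟨d, hd⟩ := nearBasis_footprint_col β O hO' hM hj₀ hT hQ hs hl (vecMulVec ζ (Pi.single i 1))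
  set W' := β.w s - l • β.w j₀ with hW'
  simp_rw [vecMulVec_single_mul_apply] at hd
  set c := β.f s (vecMulVec ζ (Pi.single i 1)) * (β.f s 1)⁻¹ with hc
  by_contra hf
  have hcne : c ≠ 0 := mul_ne_zero hf (inv_ne_zero (hO' s hs))
  have hcol : ∀ r, W' r j = (W' i j - d) * c⁻¹ * ζ r := fun r => by
    have := hd r
    field_simp
    linear_combination -this
  by_cases he : (W' i j - d) * c⁻¹ = 0
  · obtain ⟨r, hr⟩ := hne
    exact hr (by rw [hcol r, he, zero_mul])
  · exact nearBasis_col_not_on_line β O hO' hM hj₀ hζ hT hQ hs hl hcol he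

/-- **The line-column law with defect (`K₀`, `m = 2`).** At `X₀ = 1` with `|O| = 2n + 1` and `ρ, σ, j₀, l` as above
(`σ_s = l_s σ_{j₀}` on `O`, `l_{j₀} = 1`): if column `j` of every `W_t` (`t ∉ O`) lies on the line `k·ζ` (`ζ ≠ 0`) and column `j`
of `W_{j₀}` is `w₀·ζ`, then every `W` killed by all `g_t`, `t ∉ O`, has
`W_{ij} = w₀ · e(ζ e_iᵀ, W)`, `e(X,W) := Σ_{s∈O} l_s f_s(X) g_s(W)` — Brent in the reduced frame at `X = ζ e_iᵀ`: every frame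
term dies (its `j`-th column is zero, or `f_s` kills `X`), the `Z`-terms die on `K₀`, and only the defect term along `W_{j₀}` survives. -/
theorem nearLineCol_eq [DecidableEq ι] (hO' : ∀ i ∈ O, β.f i 1 ≠ 0) {ρ σ l : ι → k}
    (hM : ∀ s ∈ O, ∀ j ∈ O, β.f s 1 * β.g s (β.w j) = (if s = j then 1 else 0) + ρ s * σ j)
    {j₀ : ι} (hj₀ : j₀ ∈ O) (hl : ∀ s ∈ O, σ s = l s * σ j₀) (hl₀ : l j₀ = 1)
    {j : Fin n} {ζ : Fin 2 → k} (hζ : ζ ≠ 0) (hT : ∀ t, t ∉ O → ∃ c : k, ∀ r, β.w t r j = c * ζ r)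
    {w₀ : k} (hQ : ∀ r, β.w j₀ r j = w₀ * ζ r) {W : Matrix (Fin 2) (Fin n) k} (hW : ∀ t, t ∉ O → β.g t W = 0)
    (i : Fin 2) :
    W i j = w₀ * ∑ s ∈ O, l s * (β.f s (vecMulVec ζ (Pi.single i 1)) * β.g s W) := by
  set X := vecMulVec ζ (Pi.single i 1) with hX
  have hB := mul_eq_nearBrent β O (l := l) hl₀ X W
  -- the `Z`-terms vanish on `K₀`
  have hZ : ∑ t ∈ Finset.univ \ O, (β.f t X * β.g t W) • β.w t = 0 :=
    Finset.sum_eq_zero fun t ht => by rw [hW t (Finset.mem_sdiff.mp ht).2, mul_zero, zero_smul]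
  rw [hZ, add_zero] at hB
  -- read entry `(r, j)`
  have hr : ∀ r, ζ r * W i j = ζ r * (w₀ * ∑ s ∈ O, l s * (β.f s X * β.g s W)) := fun r => by
    have h := congr_fun (congr_fun hB r) j
    rw [vecMulVec_single_mul_apply, Matrix.add_apply, Matrix.sum_apply, Matrix.smul_apply, smul_eq_mul, hQ r] at h
    rw [h]
    have hframe : ∑ s ∈ O.erase j₀, ((β.f s X * β.g s W) • (β.w s - l s • β.w j₀)) r j = 0 := by
      refine Finset.sum_eq_zero fun s hs' => ?_
      have hs : s ∈ O := (Finset.mem_erase.mp hs').2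
      rw [Matrix.smul_apply, smul_eq_mul]
      by_cases hcolz : ∃ r', (β.w s - l s • β.w j₀) r' j ≠ 0
      · rw [near_f_vecMulVec_eq_zero β O hO' hM hj₀ hζ hT ⟨w₀, hQ⟩ hs (hl s hs) hcolz i, zero_mul, zero_mul]
      · push Not at hcolz
        rw [hcolz r, mul_zero]
    rw [hframe, zero_add]
    ring
  obtain ⟨r, hr'⟩ := Function.ne_iff.mp hζ
  exact mul_left_cancel₀ hr' (hr r)

/-- **Corollary: line columns of `K₀` vanish where `W_{j₀}` has a zero column** (`w₀ = 0`) — the saturated-case statement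
`lineCol_eq_zero_of_forall_g_eq_zero` survives for those columns. -/
theorem nearLineCol_eq_zero [DecidableEq ι] (hO' : ∀ i ∈ O, β.f i 1 ≠ 0) {ρ σ l : ι → k}
    (hM : ∀ s ∈ O, ∀ j ∈ O, β.f s 1 * β.g s (β.w j) = (if s = j then 1 else 0) + ρ s * σ j)
    {j₀ : ι} (hj₀ : j₀ ∈ O) (hl : ∀ s ∈ O, σ s = l s * σ j₀) (hl₀ : l j₀ = 1)
    {j : Fin n} {ζ : Fin 2 → k} (hζ : ζ ≠ 0) (hT : ∀ t, t ∉ O → ∃ c : k, ∀ r, β.w t r j = c * ζ r)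
    (hQ : ∀ r, β.w j₀ r j = 0) {W : Matrix (Fin 2) (Fin n) k} (hW : ∀ t, t ∉ O → β.g t W = 0) (i : Fin 2) :
    W i j = 0 := by
  have h := nearLineCol_eq β O hO' hM hj₀ hl hl₀ hζ hT (w₀ := 0) (fun r => by rw [hQ r, zero_mul]) hW i
  rw [h, zero_mul]

/-- **Partial NO-GO: the defect form has rank ≥ 2 at a line-column shape (NEAR-STRUCTURE.md §2, tensor g25).** Near-frame point
`X₀ = 1`, `|O| = 2n + 1`, data `ρ, σ, l, j₀` as above; `J` a set of fewer than `n` line columns (directions `ζ_j ≠ 0`) carrying column `j`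
of every `W_t` (`t ∉ O`) and of `W_{j₀}`; and `|ι| ≤ 2n + 2|J|` (census: `20 ≤ 12 + 8`, the T-family `LT1+LT1+J1⁴`). Then the defect form
`(X, W) ↦ e(X,W) = Σ_s l_s f_s(X) g_s(W)` restricted to `W ∈ K₀ = ⋂_{t∉O} ker g_t` is NOT of rank `≤ 1`, i.e. not of the form `e₀(X)·lam0(W)`:
otherwise `K₁ := K₀ ∩ ker lam0` has dimension `≥ 4n − |ι| ≥ 2(n − |J|)`, its line columns vanish (`nearLineCol_eq`), so `K₁ = M₀ :=` the
matrices supported off `J` — a nonzero `X`-stable space on which transport is exact (`near_transport`, the defect term being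
`ρ_s σ_{j₀} e₀(X) lam0(W) = 0`), and some `f_s` becomes multiplicative (`not_mul_hom_matrix_two`). In words: at every T-type near instance
the defect functionals `e(·,W)`, `W ∈ K₀`, span at least a plane of `(M₂/k·1)*`. -/
theorem near_lineColumnShape_defect_rank [DecidableEq ι] (hO : ∀ i, i ∉ O → β.f i 1 = 0) (hO' : ∀ i ∈ O, β.f i 1 ≠ 0)
    (hcard : O.card = 2 * n + 1) {ρ σ l : ι → k}
    (hM : ∀ s ∈ O, ∀ j ∈ O, β.f s 1 * β.g s (β.w j) = (if s = j then 1 else 0) + ρ s * σ j)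
    {j₀ : ι} (hj₀ : j₀ ∈ O) (hl : ∀ s ∈ O, σ s = l s * σ j₀) (hl₀ : l j₀ = 1)
    (J : Finset (Fin n)) (ζ : Fin n → Fin 2 → k) (hζ : ∀ j ∈ J, ζ j ≠ 0) (hJ : J.card < n)
    (hZ : Fintype.card ι ≤ 2 * n + 2 * J.card)
    (hT : ∀ t, t ∉ O → ∀ j ∈ J, ∃ c : k, ∀ r, β.w t r j = c * ζ j r)
    (w₀ : Fin n → k) (hQ : ∀ j ∈ J, ∀ r, β.w j₀ r j = w₀ j * ζ j r)
    (e₀ : Matrix (Fin 2) (Fin 2) k → k) (lam0 : Matrix (Fin 2) (Fin n) k →ₗ[k] k)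
    (hrank : ∀ W : Matrix (Fin 2) (Fin n) k, (∀ t, t ∉ O → β.g t W = 0) →
      ∀ X, ∑ s ∈ O, l s * (β.f s X * β.g s W) = e₀ X * lam0 W) : False := by
  classical
  -- `K₁` = common kernel of the `g_t`, `t ∉ O`, and of `lam0`
  set Zs : Finset ι := Finset.univ \ O with hZs
  let φ : Matrix (Fin 2) (Fin n) k →ₗ[k] (Zs → k) × k :=
    LinearMap.prod (LinearMap.pi fun t => β.g (t : ι)) lam0
  set K₁ := LinearMap.ker φ with hK₁
  have memK₁ : ∀ W, W ∈ K₁ ↔ (∀ t, t ∉ O → β.g t W = 0) ∧ lam0 W = 0 := fun W => by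
    rw [hK₁, LinearMap.mem_ker, LinearMap.prod_apply, Prod.mk_eq_zero]
    constructor
    · rintro ⟨h, h0⟩
      refine ⟨fun t ht => ?_, h0⟩
      have := congr_fun h ⟨t, Finset.mem_sdiff.mpr ⟨Finset.mem_univ t, ht⟩⟩
      simpa using this
    · rintro ⟨h, h0⟩
      refine ⟨?_, h0⟩
      funext t; simpa using h t (Finset.mem_sdiff.mp t.2).2
  set Js : Finset (Fin n) := Finset.univ \ J with hJs
  let b : Fin 2 × Js → Matrix (Fin 2) (Fin n) k := fun p => single p.1 (p.2 : Fin n) (1 : k)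
  set M₀ := Submodule.span k (Set.range b) with hM₀
  have memM₀ : ∀ W : Matrix (Fin 2) (Fin n) k, (∀ j ∈ J, ∀ i, W i j = 0) → W ∈ M₀ := by
    intro W hW
    rw [matrix_eq_sum_single W]
    refine Submodule.sum_mem _ fun i _ => Submodule.sum_mem _ fun j _ => ?_
    by_cases hj : j ∈ J
    · rw [hW j hj i, single_zero]; exact Submodule.zero_mem _
    · have : single i j (W i j) = W i j • b (i, ⟨j, Finset.mem_sdiff.mpr ⟨Finset.mem_univ j, hj⟩⟩) := by
        simp only [b, smul_single, smul_eq_mul, mul_one]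
      rw [this]
      exact Submodule.smul_mem _ _ (Submodule.subset_span ⟨_, rfl⟩)
  -- line columns of `K₁` vanish: `W_{ij} = w₀ · e(ζ e_iᵀ, W) = w₀ · e₀(·) · lam0(W) = 0`
  have hle : K₁ ≤ M₀ := fun W hW => by
    obtain ⟨hWg, hW0⟩ := (memK₁ W).mp hW
    refine memM₀ W fun j hj i => ?_
    rw [nearLineCol_eq β O hO' hM hj₀ hl hl₀ (hζ j hj) (fun t ht => hT t ht j hj) (hQ j hj) hWg i,
      hrank W hWg, hW0, mul_zero, mul_zero]
  -- dimensions: `dim M₀ ≤ 2(n − |J|) ≤ 4n − |ι| ≤ dim K₁`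
  have hdimM : finrank k M₀ ≤ 2 * (n - J.card) := by
    calc finrank k M₀ ≤ Fintype.card (Fin 2 × Js) := finrank_range_le_card b
      _ = 2 * (n - J.card) := by
          rw [Fintype.card_prod, Fintype.card_fin, Fintype.card_coe, hJs, Finset.card_sdiff,
            Finset.inter_univ, Finset.card_univ, Fintype.card_fin]
  have hdimK : 2 * n ≤ finrank k K₁ + (Fintype.card ι - O.card + 1) := by
    have h1 := LinearMap.finrank_range_add_finrank_ker φ
    rw [finrank_matrix_fin, ← hK₁] at h1
    have h2 : finrank k (LinearMap.range φ) ≤ Fintype.card ι - O.card + 1 := by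
      calc finrank k (LinearMap.range φ) ≤ finrank k ((Zs → k) × k) := Submodule.finrank_le _
        _ = Fintype.card ι - O.card + 1 := by
            rw [Module.finrank_prod, finrank_fintype_fun_eq_card, Fintype.card_coe, hZs, Finset.card_sdiff,
              Finset.inter_univ, Finset.card_univ, Module.finrank_self]
    omega
  have hOle : O.card ≤ Fintype.card ι := by
    calc O.card ≤ (Finset.univ : Finset ι).card := Finset.card_le_card (Finset.subset_univ O)
      _ = Fintype.card ι := Finset.card_univ
  have hKM : K₁ = M₀ := Submodule.eq_of_le_of_finrank_le hle (by omega)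
  -- a unit matrix in a free column and its left multiples lie in `M₀ = K₁`
  have hJs_ne : Js.Nonempty := by
    rw [← Finset.card_pos, hJs, Finset.card_sdiff, Finset.inter_univ, Finset.card_univ, Fintype.card_fin]; omega
  obtain ⟨j₁, hj₁⟩ := hJs_ne
  have hj₁J : j₁ ∉ J := (Finset.mem_sdiff.mp hj₁).2
  set W₁ : Matrix (Fin 2) (Fin n) k := single 0 j₁ 1 with hW₁
  have hK₁_of : ∀ W : Matrix (Fin 2) (Fin n) k, (∀ j ∈ J, ∀ i, W i j = 0) →
      (∀ t, t ∉ O → β.g t W = 0) ∧ lam0 W = 0 := fun W hW => (memK₁ W).mp (hKM ▸ memM₀ W hW)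
  have hW₁cols : ∀ j ∈ J, ∀ i, W₁ i j = 0 := fun j hj i =>
    single_apply_of_col_ne 0 i (ne_of_mem_of_not_mem hj hj₁J).symm 1
  have hXW₁cols : ∀ X : Matrix (Fin 2) (Fin 2) k, ∀ j ∈ J, ∀ i, (X * W₁) i j = 0 := fun X j hj i =>
    mul_single_apply_of_ne (c := (1 : k)) 0 j₁ i j (ne_of_mem_of_not_mem hj hj₁J) X
  -- exact transport on `K₁`
  have htrans : ∀ W : Matrix (Fin 2) (Fin n) k, (∀ j ∈ J, ∀ i, W i j = 0) → ∀ s ∈ O, ∀ X : Matrix (Fin 2) (Fin 2) k,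
      β.f s 1 * β.g s (X * W) = β.f s X * β.g s W := by
    intro W hW s hs X
    obtain ⟨hWg, hW0⟩ := hK₁_of W hW
    rw [near_transport β O hM hWg hs X]
    have hσ : ∑ s' ∈ O, σ s' * (β.f s' X * β.g s' W) = σ j₀ * ∑ s' ∈ O, l s' * (β.f s' X * β.g s' W) := by
      rw [Finset.mul_sum]
      exact Finset.sum_congr rfl fun s' hs' => by rw [hl s' hs']; ring
    rw [hσ, hrank W hWg X, hW0, mul_zero, mul_zero, mul_zero, add_zero]
  -- some `s ∈ O` sees `W₁`
  have hex : ∃ s ∈ O, β.g s W₁ ≠ 0 := by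
    by_contra hall
    push Not at hall
    have h := eq_sum_off_one β O hO W₁
    have hzero : W₁ = 0 := by
      rw [h]; exact Finset.sum_eq_zero fun s hs => by rw [hall s hs, mul_zero, zero_smul]
    have : W₁ 0 j₁ = (1 : k) := single_apply_same 0 j₁ 1
    rw [hzero, Matrix.zero_apply] at this
    exact zero_ne_one this
  obtain ⟨s, hs, hgs⟩ := hex
  refine not_mul_hom_matrix_two (β.f s) (hO' s hs) rfl fun A B => ?_
  have h1 := htrans W₁ hW₁cols s hs (A * B)
  have h2 := htrans (B * W₁) (hXW₁cols B) s hs A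
  have h3 := htrans W₁ hW₁cols s hs B
  rw [Matrix.mul_assoc] at h1
  have key : β.f s (A * B) * β.f s 1 * β.g s W₁ = β.f s A * β.f s B * β.g s W₁ := by
    have e1 : β.f s 1 * (β.f s 1 * β.g s (A * (B * W₁))) = β.f s 1 * (β.f s (A * B) * β.g s W₁) := by rw [h1]
    have e2 : β.f s 1 * (β.f s 1 * β.g s (A * (B * W₁))) = β.f s A * (β.f s 1 * β.g s (B * W₁)) := by
      rw [h2]; ring
    rw [h3] at e2
    linear_combination -e1 + e2
  exact mul_right_cancel₀ hgs key

end LineColumns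

end Summit.MatrixMultiplication.OmegaCensus.SmallFormats
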